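import Mathlib
import Literature.AlgebraicGeometry.Ramification.InertiaNormalSylow
import Summits.ResolutionOfSingularities.ResolutionOfSingularities.Theorems.WildQuotientsWildQuotientResolutionStubBorelCore
import Summits.ResolutionOfSingularities.ResolutionOfSingularities.Theorems.WildQuotientsWildQuotientResolutionFlagStep
import HarnessLib

/-!
# Point blow-up step of Phase 0 in ARBITRARY embedding dimension (crux `WildQuotients.WildQuotientResolution`)

Crux stmt-ResolutionOfSingularities-15640 (`WildQuotientResolution`), line `Sketch` (card
`p-closure-sylow-separation`), registered stub `stub_phaseZeroHighDim` (= PhaseZeroModel for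
`dim X′ ≥ 3`). The surface theorem `PhaseZeroDimTwo.phaseZero_dimLE_two` blows up the finite set
of closed points with non-p-closed inertia and feeds the local package
`PointBlowupStalkData.stub_pointBlowupStalkData` (`ι = π♯_x : 𝒪_{X′,z} → 𝒪_{X♯,x}` injective local,
`𝔪_z 𝒪_{X♯,x} = (ι t)`, the inertia `I_x` acting faithfully on `𝒪_{X′,z}` and residue-trivially on
`𝒪_{X♯,x}`, compatibly) into `BorelCore.stub_borelCore`, whose only dimension-dependent
hypothesis is `dim_κ 𝔪_z/𝔪_z² ≤ 2`. This file is the drop-in replacement of that last step in any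
dimension, obtained from the general blow-up step `FlagStep.hasNormalSylow_of_blowupStep` with
`J = 𝔪_z` (so the top piece `𝔪/(J + 𝔪²)` vanishes):

**Theorem** (`hasNormalSylow_of_pointBlowupStep`). With the point blow-up stalk package at `x`
over `z`, the inertia `I_x` is p-closed as soon as its action on the hyperplane
`W̄ = {r ∈ 𝔪_z | ι r ∈ 𝔫_x · ι t} mod 𝔪_z²` of the cotangent space at `z` (the cotangent
directions vanishing at `x` on the exceptional divisor) factors through a finite p-closed group.
For `dim 𝔪_z/𝔪_z² ≤ 2` the hyperplane is a line and the condition is automatic (BorelCore); from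
dimension `3` on it is the inductive input of a Phase 0 tower.

[OURS · crux stmt-ResolutionOfSingularities-15640 · helper toward `stub_phaseZeroHighDim`; folklore
local algebra, counted 0; AI-level work, weaker than expert review.]

* `hasNormalSylow_punit` — the trivial group is p-closed.
* `hasNormalSylow_of_pointBlowupStep` — the theorem.
-/

-- single-problem summit: the doubled namespace component `ResolutionOfSingularities` is forced
set_option linter.dupNamespace false

open IsLocalRing Literature.AlgebraicGeometry.Ramification
open Summit.ResolutionOfSingularities.ResolutionOfSingularities.Theorems.WildQuotientResolution.BorelCore
open Summit.ResolutionOfSingularities.ResolutionOfSingularities.Theorems.WildQuotientResolution.FlagStep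

namespace Summit.ResolutionOfSingularities.ResolutionOfSingularities.Theorems.WildQuotientResolution.FlagStepPoint

/-- The trivial group has a normal Sylow `p`-subgroup. [folklore] -/
theorem hasNormalSylow_punit {p : ℕ} [Fact p.Prime] : HasNormalSylow p PUnit.{1} :=
  HasNormalSylow.of_not_dvd_card (by
    rw [Nat.card_unique]
    exact fun h => (Fact.out : p.Prime).one_lt.ne' (Nat.dvd_one.mp h))

/-- **Point blow-up step of Phase 0, any embedding dimension** (crux
stmt-ResolutionOfSingularities-15640, toward `stub_phaseZeroHighDim`). Let `(R, 𝔪, κ)` be a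
Noetherian local ring and `(S, 𝔫, κ₁)` a local domain, both residue fields of characteristic `p`;
`ι : R → S` an injective local homomorphism with `𝔪 S = ι(t) S` for some `t ∈ 𝔪` (the shape
delivered by `PointBlowupStalkData.stub_pointBlowupStalkData`); `I` a finite group acting on `R`
faithfully by `τ` and on `S` by `τ₁`, compatibly and residue-trivially on `S`. If the action of
`I` on the hyperplane `W̄ = {r ∈ 𝔪 | ι r ∈ 𝔫 · ι t} mod 𝔪²` factors through a finite p-closed
group `A` (`f : I →* A` whose kernel moves each such `r` inside `𝔪²`), then `I` has a normal
Sylow `p`-subgroup. (`FlagStep.hasNormalSylow_of_blowupStep` with `J = 𝔪` and trivial top piece;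
`BorelCore.stub_borelCore` is the case `dim 𝔪/𝔪² ≤ 2`, where `W̄` is a line.) [folklore] -/
theorem hasNormalSylow_of_pointBlowupStep (p : ℕ) [Fact p.Prime]
    {R S : Type*} [CommRing R] [IsLocalRing R] [IsNoetherianRing R]
    [CommRing S] [IsLocalRing S] [IsDomain S]
    [CharP (ResidueField R) p] [CharP (ResidueField S) p]
    (ι : R →+* S) [IsLocalHom ι] (hι : Function.Injective ι)
    (t : R) (ht : t ∈ maximalIdeal R)
    (hgen : Ideal.map ι (maximalIdeal R) = Ideal.span {ι t})
    {I : Type*} [Group I] [Finite I] (τ : I →* (R ≃+* R)) (τ₁ : I →* (S ≃+* S))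
    (hτ : Function.Injective τ) (hcomp : ∀ (g : I) (r : R), ι (τ g r) = τ₁ g (ι r))
    (hres : ∀ (g : I) (s : S), τ₁ g s - s ∈ maximalIdeal S)
    {A : Type*} [Group A] [Finite A] (hA : HasNormalSylow p A) (f : I →* A)
    (hf : ∀ g, f g = 1 → ∀ r ∈ maximalIdeal R,
      (∃ s ∈ maximalIdeal S, ι r = s * ι t) → τ g r - r ∈ maximalIdeal R ^ 2) :
    HasNormalSylow p I :=
  hasNormalSylow_of_blowupStep p ι hι (maximalIdeal R) t ht hgen τ τ₁ hτ
    (fun g _ hj => ringAut_apply_mem_maximalIdeal (τ g) hj) hcomp hres hA hasNormalSylow_punit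
    f hf (1 : I →* PUnit.{1}) fun g _ _ hr =>
      Submodule.mem_sup_left (sub_mem (ringAut_apply_mem_maximalIdeal (τ g) hr) hr)

end Summit.ResolutionOfSingularities.ResolutionOfSingularities.Theorems.WildQuotientResolution.FlagStepPoint
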